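import Literature.NumberTheory.Automorphic.UnipotentAveragesIdempotent
import HarnessLib

/-!
# Vanishing unipotent averages at one finite place give the global hypothesis `(H_k)`
(Jacquet–Langlands, LNM 114 (1970), §16, p. 503; Arthur–Clozel (1989), Ch. 1, Lemma 2.4:
"`f_{v₁}` is a coefficient of a supercuspidal representation of `G(F_{v₁})` … the operator `r(f)`
sends the space of `L²` automorphic forms in the space of cusp forms")

Topic `NumberTheory/Automorphic`; theorems only (no definition, no named fact, no instance visible
to importers). Third file of the local-to-global passage for the cuspidal image of `R(η)`
(`SupercuspTypeCuspidalImage`: global hypothesis `(H_k)`; `UnipotentAveragesIdempotent`: `(H_k)`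
from the vanishing over the `e`-part `e 𝔫_k(𝔸_K)` for an idempotent adele `e`). Here `e = e_w`
is the indicator `(0_∞; 1 at w, 0 elsewhere)` of a single finite place `w` (`adeleSingleHom K w 1`,
`GLnAdelicStructure`), and the `e_w`-part of `𝔫_k(𝔸_K)` is identified, as a topological group, with
the local group `𝔫_k(K_w)` through the entrywise factor inclusion `ι_w : K_w → 𝔸_K`
(`adeleSingleHom`, continuous by `continuous_adeleSingleHom`; inverse the projection `adeleEval`),
under which `1 + ι_w(Y) = GLn.ofLocal w (1 + Y)`:

* `isIdempotentElem_adeleSingleHom_one` — `e_w² = e_w` (and `e_w · x = ι_w(x_w)` is the tree's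
  `adeleSingleHom_one_mul` of `JacquetLanglandsParts`).
* `glUnipotent_map_adeleSingleHom` — `1 + ι_w(Y) = GLn.ofLocal n K w (1 + Y)` in `GL_n(𝔸_K)` for
  `Y ∈ 𝔫_k(K_w)`.
* `integral_comp_glUnipotent_eq_zero_of_place` — **if
  `∫_{𝔫_k(K_w)} η(p · GLn.ofLocal w (1 + Y) · r) dY = 0` for all `p, r ∈ GL_n(𝔸_K)` and one additive
  Haar measure `dY` of `𝔫_k(K_w)` (any Borel structure), then
  `∫_{𝔫_k(𝔸_K)} η(p (1 + Y) r) dν(Y) = 0` for every Haar measure `ν` and all `p, r`** (transport the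
  Haar measure along `𝔫_k(K_w) ≃ e_w 𝔫_k(𝔸_K)` and apply
  `integral_comp_glUnipotent_eq_zero_of_idempotent`).
* `integratedOperator_rightRegular_mem_cuspidalSubspace_of_place` — **`R(η)` has cuspidal image,
  kills `L²_cuspᗮ` and factors through `P_cusp` as soon as for each `0 < k < n` there is a finite
  place `w_k` at which the `N_k(K_{w_k})`-averages of `η` vanish** — in particular (with
  `SupercuspFormUnipotentIntegral.integral_matrixCoeff_unipotent_eq_zero`) when `η` is, along
  `GL_n(K_w)`, a matrix coefficient of a smooth supercuspidal representation cut off by factors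
  constant along `N_k(K_w)`: the printed hypothesis of Jacquet–Langlands p. 503 / Arthur–Clozel
  Lemma 2.4.

## References

* H. Jacquet, R. P. Langlands, *Automorphic forms on `GL(2)`*, LNM 114 (1970), §16, p. 503
  [JacquetLanglands1970].
* J. Arthur, L. Clozel, *Simple algebras, base change, and the advanced theory of the trace
  formula*, Ann. of Math. Studies 120 (1989), Ch. 1, Lemma 2.4, pp. 18–20 [ArthurClozel1989].
-/

noncomputable section

open MeasureTheory Measure Set Filter Topology IsDedekindDomain NumberField
open CompactlySupported
open scoped ENNReal NNReal Pointwise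

namespace Literature.NumberTheory.Automorphic

/-! ### The idempotent `e_w` of a finite place and the factor inclusion -/

section Place

variable {K : Type} [Field K] [NumberField K] (w : HeightOneSpectrum (𝓞 K))

/-- `e_w = ι_w(1)` is idempotent (`ι_w` is multiplicative). [folklore] -/
theorem isIdempotentElem_adeleSingleHom_one : IsIdempotentElem (adeleSingleHom K w 1) := by
  change adeleSingleHom K w 1 * adeleSingleHom K w 1 = adeleSingleHom K w 1
  rw [← map_mul, mul_one]

/-- `ι_w(y)` is fixed by multiplication with `e_w`. [folklore] -/
theorem adeleSingleHom_one_mul_adeleSingleHom (y : w.adicCompletion K) :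
    adeleSingleHom K w 1 * adeleSingleHom K w y = adeleSingleHom K w y := by
  rw [← map_mul, one_mul]

variable {n k : ℕ}

/-- The entrywise factor inclusion preserves the block shape: `ι_w(Y) ∈ 𝔫_k(𝔸_K)` for
`Y ∈ 𝔫_k(K_w)`. [folklore] -/
theorem map_adeleSingleHom_mem_blockNilpotent (Y : blockNilpotent n k (w.adicCompletion K)) :
    (Y : Matrix (Fin n) (Fin n) (w.adicCompletion K)).map (adeleSingleHom K w) ∈
      blockNilpotent n k (AdeleRing (𝓞 K) K) := by
  intro i j hij
  refine Y.2 i j fun h0 => hij ?_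
  rw [Matrix.map_apply, h0, map_zero]

/-- The entrywise projection preserves the block shape: `X_w ∈ 𝔫_k(K_w)` for `X ∈ 𝔫_k(𝔸_K)`.
[folklore] -/
theorem map_adeleEval_mem_blockNilpotent (X : blockNilpotent n k (AdeleRing (𝓞 K) K)) :
    (X : Matrix (Fin n) (Fin n) (AdeleRing (𝓞 K) K)).map (AdelicGroupData.adeleEval K w) ∈
      blockNilpotent n k (w.adicCompletion K) := by
  intro i j hij
  refine X.2 i j fun h0 => hij ?_
  rw [Matrix.map_apply, h0, map_zero]

/-- **`1 + ι_w(Y) = GLn.ofLocal w (1 + Y)`** in `GL_n(𝔸_K)` for `Y ∈ 𝔫_k(K_w)` (entrywise: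
`δ_{ij} + ι_w((1 + Y)_{ij} - δ_{ij}) = δ_{ij} + ι_w(Y_{ij})`, `GLn.coe_ofLocal_apply`). [folklore] -/
theorem glUnipotent_map_adeleSingleHom (Y : blockNilpotent n k (w.adicCompletion K)) :
    glUnipotent n k K (Multiplicative.ofAdd
      (⟨(Y : Matrix (Fin n) (Fin n) (w.adicCompletion K)).map (adeleSingleHom K w),
        map_adeleSingleHom_mem_blockNilpotent w Y⟩ : blockNilpotent n k (AdeleRing (𝓞 K) K))) =
      GLn.ofLocal n K w (unipotentOfBlock n k (w.adicCompletion K) (Multiplicative.ofAdd Y)) := by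
  refine Units.ext (Matrix.ext fun i j => ?_)
  rw [GLn.coe_ofLocal_apply, coe_unipotentOfBlock, toAdd_ofAdd, Matrix.add_apply,
    add_sub_cancel_left]
  rfl

end Place

/-! ### From one place to the global hypothesis -/

section Global

variable {n k : ℕ} {K : Type} [Field K] [NumberField K]

attribute [local instance] adelicBorel borelSpace_adelic locallyCompactSpace_adelic
  secondCountableTopology_gl_adelic

/-- **Vanishing unipotent averages at one finite place give `(H_k)`.** Let `w` be a finite place of
`K`, `𝔫_k(K_w)` endowed with any Borel σ-algebra and an additive Haar measure `dY`, and
`η ∈ C_c(GL_n(𝔸_K))` with `∫_{𝔫_k(K_w)} η(p · ι_w(1 + Y) · r) dY = 0` for all `p, r ∈ GL_n(𝔸_K)`,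
where `ι_w : GL_n(K_w) →* GL_n(𝔸_K)` is the local embedding `GLn.ofLocal` (passed as any
homomorphism into the type `(AdelicGroupData.gl n K).Adelic` agreeing with it pointwise, e.g.
`GLn.toAdelic` of `GLnCuspidalSpectrumProofs`, so that the products stay in that type). Then `∫_{𝔫_k(𝔸_K)} η(p (1 + Y) r) dν(Y) = 0` for every Haar measure `ν` of
`𝔫_k(𝔸_K)` and all `p, r` — the global hypothesis `(H_k)` of `SupercuspTypeCuspidalImage`. Proof:
`Y ↦ ι_w(Y)` is an isomorphism of topological groups from `𝔫_k(K_w)` onto the `e_w`-part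
`e_w 𝔫_k(𝔸_K)` (inverse the entrywise `w`-component, `e_w · x = ι_w(x_w)`), carrying `dY` to a Haar
measure `α₁` there with `∫_{e_w 𝔫_k(𝔸_K)} η(p (1 + Y₁) r) dα₁ = ∫ η(p · GLn.ofLocal w (1 + Y) · r) dY
= 0`; now apply `integral_comp_glUnipotent_eq_zero_of_idempotent`. (Jacquet–Langlands (1970),
p. 503; Arthur–Clozel (1989), Ch. 1, Lemma 2.4.) [cite: ArthurClozel1989, Ch. 1 Lemma 2.4] -/
theorem integral_comp_glUnipotent_eq_zero_of_place (w : HeightOneSpectrum (𝓞 K))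
    [MeasurableSpace (blockNilpotent n k (w.adicCompletion K))]
    [BorelSpace (blockNilpotent n k (w.adicCompletion K))]
    (ιw : GL (Fin n) (w.adicCompletion K) →* (AdelicGroupData.gl n K).Adelic)
    (hιw : ∀ g, ιw g = GLn.ofLocal n K w g)
    {η : (AdelicGroupData.gl n K).Adelic → ℂ} (hη : Continuous η) (hηs : HasCompactSupport η)
    (αw : Measure (blockNilpotent n k (w.adicCompletion K))) [αw.IsAddHaarMeasure]
    (h0 : ∀ p r : (AdelicGroupData.gl n K).Adelic,
      ∫ Y, η (p * ιw (unipotentOfBlock n k (w.adicCompletion K) (Multiplicative.ofAdd Y)) * r) ∂αw = 0)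
    (ν : Measure (blockNilpotent n k (AdeleRing (𝓞 K) K))) [ν.IsAddHaarMeasure]
    (p r : (AdelicGroupData.gl n K).Adelic) :
    ∫ Y, η (p * glUnipotent n k K (Multiplicative.ofAdd Y) * r) ∂ν = 0 := by
  set e : AdeleRing (𝓞 K) K := adeleSingleHom K w 1 with he_def
  have he : IsIdempotentElem e := isIdempotentElem_adeleSingleHom_one w
  -- the factor inclusion and the projection on block-nilpotent matrices
  let ι : blockNilpotent n k (w.adicCompletion K) →+ blockNilpotent n k (AdeleRing (𝓞 K) K) :=
    (((adeleSingleHom K w).toAddMonoidHom.mapMatrix).comp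
      (blockNilpotent n k (w.adicCompletion K)).subtype).codRestrict
      (blockNilpotent n k (AdeleRing (𝓞 K) K)) (fun Y => map_adeleSingleHom_mem_blockNilpotent w Y)
  have hι_apply : ∀ (Y : blockNilpotent n k (w.adicCompletion K)) (i j : Fin n),
      ((ι Y : blockNilpotent n k (AdeleRing (𝓞 K) K)) : Matrix (Fin n) (Fin n) (AdeleRing (𝓞 K) K)) i j =
        adeleSingleHom K w ((Y : Matrix (Fin n) (Fin n) (w.adicCompletion K)) i j) := fun _ _ _ => rfl
  let ev : blockNilpotent n k (AdeleRing (𝓞 K) K) → blockNilpotent n k (w.adicCompletion K) :=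
    fun X => ⟨(X : Matrix (Fin n) (Fin n) (AdeleRing (𝓞 K) K)).map (AdelicGroupData.adeleEval K w),
      map_adeleEval_mem_blockNilpotent w X⟩
  have hev_apply : ∀ (X : blockNilpotent n k (AdeleRing (𝓞 K) K)) (i j : Fin n),
      ((ev X : blockNilpotent n k (w.adicCompletion K)) : Matrix (Fin n) (Fin n) (w.adicCompletion K)) i j =
        AdelicGroupData.adeleEval K w ((X : Matrix (Fin n) (Fin n) (AdeleRing (𝓞 K) K)) i j) :=
    fun _ _ _ => rfl
  -- `e ι(Y) = ι(Y)`, `ev ι = id`, `ι ev = id` on the `e`-part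
  have hιe : ∀ Y : blockNilpotent n k (w.adicCompletion K), blockScale e (ι Y) = ι Y := by
    intro Y
    refine Subtype.ext (Matrix.ext fun i j => ?_)
    rw [blockScale_apply_apply, hι_apply, he_def, adeleSingleHom_one_mul_adeleSingleHom]
  have hevι : ∀ Y : blockNilpotent n k (w.adicCompletion K), ev (ι Y) = Y := by
    intro Y
    refine Subtype.ext (Matrix.ext fun i j => ?_)
    rw [hev_apply, hι_apply, adeleEval_adeleSingleHom]
  have hιev : ∀ X : blockNilpotent n k (AdeleRing (𝓞 K) K),
      X ∈ (blockScale (n := n) (k := k) e).range → ι (ev X) = X := by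
    rintro _ ⟨X, rfl⟩
    refine Subtype.ext (Matrix.ext fun i j => ?_)
    rw [hι_apply, hev_apply, blockScale_apply_apply, he_def,
      map_mul, adeleEval_adeleSingleHom, one_mul, ← adeleSingleHom_one_mul K w]
  -- the isomorphism of topological groups `𝔫_k(K_w) ≃ e 𝔫_k(𝔸_K)`
  let Φ : blockNilpotent n k (w.adicCompletion K) ≃+ (blockScale (n := n) (k := k) e).range :=
    { toFun := fun Y => ⟨ι Y, ι Y, hιe Y⟩
      invFun := fun X => ev X.1
      left_inv := fun Y => hevι Y
      right_inv := fun X => Subtype.ext (hιev X.1 X.2)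
      map_add' := fun Y Y' => Subtype.ext (map_add ι Y Y') }
  have hΦ_coe : ∀ Y : blockNilpotent n k (w.adicCompletion K),
      ((Φ Y : (blockScale (n := n) (k := k) e).range) : blockNilpotent n k (AdeleRing (𝓞 K) K)) = ι Y :=
    fun _ => rfl
  have hιc : Continuous ι := by
    refine Continuous.subtype_mk ?_ _
    exact continuous_subtype_val.matrix_map (continuous_adeleSingleHom K w)
  have hevc : Continuous ev := by
    refine Continuous.subtype_mk ?_ _
    exact continuous_subtype_val.matrix_map (AdelicGroupData.continuous_adeleEval K w)
  have hΦc : Continuous Φ := hιc.subtype_mk _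
  have hΦsc : Continuous Φ.symm := hevc.comp continuous_subtype_val
  -- transport the Haar measure
  haveI : BorelSpace (blockScale (n := n) (k := k) e).range := Subtype.borelSpace _
  haveI : (Measure.map Φ αw).IsAddHaarMeasure := Φ.isAddHaarMeasure_map αw hΦc hΦsc
  have hme : MeasurableEmbedding Φ := (Homeomorph.mk Φ.toEquiv hΦc hΦsc).measurableEmbedding
  refine integral_comp_glUnipotent_eq_zero_of_idempotent he hη hηs (Measure.map Φ αw)
    (fun p' r' => ?_) ν p r
  rw [hme.integral_map]
  have h1 : ∀ Y : blockNilpotent n k (w.adicCompletion K),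
      η (p' * glUnipotent n k K (Multiplicative.ofAdd
        ((Φ Y : (blockScale (n := n) (k := k) e).range) : blockNilpotent n k (AdeleRing (𝓞 K) K))) * r') =
      η (p' * ιw (unipotentOfBlock n k (w.adicCompletion K) (Multiplicative.ofAdd Y)) * r') := by
    intro Y
    rw [hΦ_coe, hιw, ← glUnipotent_map_adeleSingleHom w Y]
    rfl
  simp_rw [h1]
  exact h0 p' r'

variable {μ : Measure (AdelicGroupData.gl n K).automorphicQuotient}
  [(AdelicGroupData.gl n K).IsAutomorphicMeasure μ]

/-- **`R(η)` has cuspidal image when, for each `0 < k < n`, the `N_k`-averages of `η` vanish at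
some finite place `w_k`** (Jacquet–Langlands (1970), §16, p. 503; Arthur–Clozel (1989), Ch. 1,
Lemma 2.4: a factor of the test function is a supercusp form at one place). For
`η ∈ C_c(GL_n(𝔸_K))`, finite places `w_k` with Borel σ-algebras and Haar measures `dY` on the
`𝔫_k(K_{w_k})`, and `∫_{𝔫_k(K_{w_k})} η(p · GLn.ofLocal w_k (1 + Y) · r) dY = 0` for all `p, r` and
all `0 < k < n`: `R(η) f ∈ L²_cusp` for every `f ∈ L²`, `R(η)` annihilates `L²_cuspᗮ`, and
`R(η) = R(η) ∘ P_cusp` (`R(η)` the integrated operator of the regular representation for an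
inversion-invariant Haar measure `ν` of `GL_n(𝔸_K)`). The local vanishing is supplied, for `η`
built from a matrix coefficient of a smooth supercuspidal representation of `GL_n(K_{w_k})`, by
`integral_matrixCoeff_unipotent_eq_zero` (`SupercuspFormUnipotentIntegral`).
[cite: ArthurClozel1989, Ch. 1 Lemma 2.4] [cite: JacquetLanglands1970, §16 p. 503] -/
theorem integratedOperator_rightRegular_mem_cuspidalSubspace_of_place
    {η : C_c((AdelicGroupData.gl n K).Adelic, ℂ)} (w : ℕ → HeightOneSpectrum (𝓞 K))
    [∀ k, MeasurableSpace (blockNilpotent n k ((w k).adicCompletion K))]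
    [∀ k, BorelSpace (blockNilpotent n k ((w k).adicCompletion K))]
    (ι : ∀ k, GL (Fin n) ((w k).adicCompletion K) →* (AdelicGroupData.gl n K).Adelic)
    (hι : ∀ k g, ι k g = GLn.ofLocal n K (w k) g)
    (α : ∀ k, Measure (blockNilpotent n k ((w k).adicCompletion K)))
    (hα : ∀ k, 0 < k → k < n → (α k).IsAddHaarMeasure)
    (h0 : ∀ k, 0 < k → k < n → ∀ p r : (AdelicGroupData.gl n K).Adelic,
      ∫ Y, η (p * ι k (unipotentOfBlock n k ((w k).adicCompletion K) (Multiplicative.ofAdd Y)) * r)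
        ∂(α k) = 0)
    (ν : Measure (AdelicGroupData.gl n K).Adelic) [ν.IsHaarMeasure] [ν.IsInvInvariant] :
    (∀ f : (AdelicGroupData.gl n K).L2 μ,
      ((AdelicGroupData.gl n K).rightRegular μ).integratedOperator
          ((AdelicGroupData.gl n K).isUnitary_rightRegular μ)
          ((AdelicGroupData.gl n K).isStronglyContinuous_rightRegular_holds μ) ν η f ∈
        cuspidalSubspace n K μ) ∧
    (∀ f : (AdelicGroupData.gl n K).L2 μ, f ∈ (cuspidalSubspace n K μ).toSubmoduleᗮ →
      ((AdelicGroupData.gl n K).rightRegular μ).integratedOperator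
          ((AdelicGroupData.gl n K).isUnitary_rightRegular μ)
          ((AdelicGroupData.gl n K).isStronglyContinuous_rightRegular_holds μ) ν η f = 0) ∧
    ((AdelicGroupData.gl n K).rightRegular μ).integratedOperator
        ((AdelicGroupData.gl n K).isUnitary_rightRegular μ)
        ((AdelicGroupData.gl n K).isStronglyContinuous_rightRegular_holds μ) ν η =
      (((AdelicGroupData.gl n K).rightRegular μ).integratedOperator
        ((AdelicGroupData.gl n K).isUnitary_rightRegular μ)
        ((AdelicGroupData.gl n K).isStronglyContinuous_rightRegular_holds μ) ν η).comp
        (cuspidalSubspace n K μ).toSubmodule.starProjection := by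
  have hH : ∀ k, 0 < k → k < n →
      ∀ (ν𝔫 : Measure (blockNilpotent n k (AdeleRing (𝓞 K) K))) [ν𝔫.IsAddHaarMeasure]
        (p r : (AdelicGroupData.gl n K).Adelic),
        ∫ Y, η (p * glUnipotent n k K (Multiplicative.ofAdd Y) * r) ∂ν𝔫 = 0 := by
    intro k hk hkn ν𝔫 _ p r
    haveI := hα k hk hkn
    exact integral_comp_glUnipotent_eq_zero_of_place (w k) (ι k) (hι k) η.continuous
      η.hasCompactSupport (α k) (h0 k hk hkn) ν𝔫 p r
  exact ⟨fun f => integratedOperator_rightRegular_mem_cuspidalSubspace hH ν f,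
    fun f hf => integratedOperator_rightRegular_eq_zero_of_mem_orthogonal hH ν hf,
    integratedOperator_rightRegular_eq_comp_starProjection hH ν⟩

end Global

end Literature.NumberTheory.Automorphic
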